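import Summits.AnomalousDissipation.AnomalousDissipation.Theses.EnsembleRigidity
import Summits.AnomalousDissipation.AnomalousDissipation.Theorems.EnsembleRigidityResidualTransferSSSGreenCS
import Summits.AnomalousDissipation.AnomalousDissipation.Theorems.EnsembleRigidityResidualTransferSSSDefectIdentity
import Summits.AnomalousDissipation.AnomalousDissipation.Theorems.EnsembleRigidityResidualTransferSSSTestEnstrophyTame
import Summits.AnomalousDissipation.AnomalousDissipation.Theorems.EnsembleRigidityResidualTransferSSSEnsembleCS
import Literature.Analysis.FluidPDE.CylindricalGenerator
import Literature.Analysis.FluidPDE.StatisticalSolutionDirac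
import Literature.Analysis.FunctionSpaces.TorusFourierCalculus
import HarnessLib

/-!
# Route EnsembleRigidity — crux `ResidualTransferSSS` (line `Sketch`)

Proof of the route declaration
`Summit.AnomalousDissipation.AnomalousDissipation.Theses.EnsembleRigidity.ResidualTransferSSS`
(item stmt-AnomalousDissipation-15510): RESIDUAL TRANSFER AT THE ENSEMBLE LEVEL. For `ν > 0`, a smooth
force `f` and a stationary statistical solution `μ` of NS_ν(f) on `T³` (Foias–Manley–Rosa–Temam 2001,
Ch. IV Def. 1.3, (1.29)–(1.31)):

* (a) the work of the force is non-negative on every energy shell,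
  `0 ≤ ∫_{e₁ ≤ |v|² < e₂} (v, f) dμ` — the shell energy inequality (1.31) with `ν ∫ ‖∇v‖² ≥ 0`, both
  summands being `μ`-integrable by (1.29) (`shellWork_nonneg`);
* (b) for every cylindrical test functional `Φ` the forced-Euler generator `⟨f − B(v,v), Φ'(v)⟩`
  (`nsGeneratorPairing 0 f v (Φ.grad v)`) is `μ`-integrable and
  `|∫ ⟨f − B(v,v), Φ'(v)⟩ dμ| ≤ ν (∫ ‖∇v‖² dμ)^{1/2} (∫ ‖∇Φ'(v)‖² dμ)^{1/2}` (`eulerDefect_le`):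
  the Liouville equation (1.30) gives `∫ ⟨f − B(v,v), Φ'(v)⟩ dμ = −ν ∫ (v, ΔΦ'(v)) dμ`
  (`stub_defectIdentity`), the spectral Green–Cauchy–Schwarz bound
  `|(v, Δw)| ≤ ‖∇v‖ ‖∇w‖` for `v ∈ L²` of finite spectral enstrophy and smooth `w`
  (`stub_greenCS`, FMRT Ch. IV §1.1: `(Au, v) = ((u, v))` on `V`), the boundedness and continuity of
  `v ↦ ‖∇Φ'(v)‖²` on `H` (`stub_testEnstrophyTame`) and the Cauchy–Schwarz inequality in `L²(μ)`
  (`stub_ensembleCS`).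

## References

* C. Foias, O. Manley, R. Rosa, R. Temam, *Navier–Stokes Equations and Turbulence* (CUP 2001),
  Ch. IV §1.1 (display after (1.10)), §1.2 Def. 1.3, (1.29)–(1.31). [FoiasManleyRosaTemam2001]
-/

-- `Summit.<Summit>.<Problem>` is the tree's mandated summit-side namespace (CONVENTIONS §2); single-conjunct summit, duplicate deliberate.
set_option linter.dupNamespace false

noncomputable section

namespace Summit.AnomalousDissipation.AnomalousDissipation.Theorems.ResidualTransferSSS

open MeasureTheory Filter Topology UnitAddTorus
open scoped InnerProductSpace RealInnerProductSpace ENNReal NNReal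
open Literature.Analysis.FunctionSpaces Literature.Analysis.FluidPDE

variable {d : Type*} [Fintype d] [DecidableEq d]

/-! The four registered stubs of the skeleton are the landed helper files imported above:
`stub_greenCS` (`…GreenCS`), `stub_defectIdentity` (`…DefectIdentity`), `stub_testEnstrophyTame`
(`…TestEnstrophyTame`), `stub_ensembleCS` (`…EnsembleCS`), all in this namespace. -/

/-! ## Part (a): the work of the force is non-negative on energy shells -/

/-- **Shell positivity of the work** (FMRT 2001, Ch. IV (1.31) with (1.29)): for a stationary
statistical solution with `0 ≤ ν` and `f ∈ L²`, `0 ≤ ∫_{e₁ ≤ |v|² < e₂} (v, f) dμ` on every energy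
shell — the shell energy inequality `∫_shell (ν‖∇v‖² − (v,f)) dμ ≤ 0` splits because both summands are
`μ`-integrable, and `ν ∫_shell ‖∇v‖² dμ ≥ 0`. [folklore] -/
theorem shellWork_nonneg {ν : ℝ} (hν : 0 ≤ ν) {f : UnitAddTorus d → EuclideanSpace ℝ d}
    (hf : MemLp f 2 volume) {μ : Measure (Torus.energySpace d)}
    (hμ : Torus.IsStationaryStatisticalSolution ν f μ) {e₁ e₂ : ℝ≥0∞} (he : e₁ < e₂) :
    0 ≤ ∫ u in {u : Torus.energySpace d | e₁ ≤ ‖u‖ₑ ^ 2 ∧ ‖u‖ₑ ^ 2 < e₂},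
      Torus.pairing (u : Lp (EuclideanSpace ℝ d) 2 (volume : Measure (UnitAddTorus d))) f ∂μ := by
  have h := hμ.energy_ineq e₁ e₂ he
  have hA : Integrable (fun u : Torus.energySpace d =>
      ν * (Torus.eGradNormSq ((u : Lp (EuclideanSpace ℝ d) 2 (volume : Measure (UnitAddTorus d))) :
        UnitAddTorus d → EuclideanSpace ℝ d)).toReal)
      (μ.restrict {u : Torus.energySpace d | e₁ ≤ ‖u‖ₑ ^ 2 ∧ ‖u‖ₑ ^ 2 < e₂}) :=
    (hμ.integrable_toReal_eGradNormSq.const_mul ν).restrict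
  have hB : Integrable (fun u : Torus.energySpace d =>
      Torus.pairing (u : Lp (EuclideanSpace ℝ d) 2 (volume : Measure (UnitAddTorus d))) f)
      (μ.restrict {u : Torus.energySpace d | e₁ ≤ ‖u‖ₑ ^ 2 ∧ ‖u‖ₑ ^ 2 < e₂}) :=
    (hμ.integrable_pairing hf).restrict
  rw [integral_sub hA hB, sub_nonpos, integral_const_mul] at h
  exact le_trans (mul_nonneg hν (integral_nonneg fun _ => ENNReal.toReal_nonneg)) h

/-! ## Part (b): the Euler defect bound -/

/-- **The Euler defect bound of a stationary statistical solution**: for `0 < ν`, `f ∈ L²` and every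
cylindrical `Φ`, `v ↦ ⟨f − B(v,v), Φ'(v)⟩` is `μ`-integrable and
`|∫ ⟨f − B(v,v), Φ'(v)⟩ dμ| ≤ ν (∫ ‖∇v‖² dμ)^{1/2} (∫ ‖∇Φ'(v)‖² dμ)^{1/2}` (FMRT 2001, Ch. IV
(1.29)–(1.30) and §1.1). [folklore] -/
theorem eulerDefect_le {ν : ℝ} (hν : 0 < ν) {f : UnitAddTorus d → EuclideanSpace ℝ d}
    (hf : MemLp f 2 volume) {μ : Measure (Torus.energySpace d)}
    (hμ : Torus.IsStationaryStatisticalSolution ν f μ) (Φ : Torus.CylindricalTest d) :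
    Integrable (fun u : Torus.energySpace d => Torus.nsGeneratorPairing 0 f u (Φ.grad u)) μ ∧
      |∫ u, Torus.nsGeneratorPairing 0 f u (Φ.grad u) ∂μ| ≤
        ν * Real.sqrt (Torus.ensembleEnstrophy μ).toReal *
          Real.sqrt (∫ u, Torus.gradNormSq (Φ.grad u) ∂μ) := by
  haveI := hμ.prob
  obtain ⟨hint, hid⟩ := stub_defectIdentity hν.ne' hf hμ Φ
  refine ⟨hint, ?_⟩
  -- the enstrophy density `a` and the test enstrophy `b`
  have haI : Integrable (fun u : Torus.energySpace d =>
      (Torus.eGradNormSq ((u : Lp (EuclideanSpace ℝ d) 2 (volume : Measure (UnitAddTorus d))) :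
        UnitAddTorus d → EuclideanSpace ℝ d)).toReal) μ :=
    hμ.integrable_toReal_eGradNormSq
  obtain ⟨hbc, C, hC⟩ := stub_testEnstrophyTame Φ
  have hbI : Integrable (fun u : Torus.energySpace d => Torus.gradNormSq (Φ.grad u)) μ := by
    refine Integrable.mono' (integrable_const (max C 0)) hbc.aestronglyMeasurable
      (ae_of_all _ fun u => ?_)
    rw [Real.norm_of_nonneg (Torus.gradNormSq_nonneg _)]
    exact (hC u).trans (le_max_left _ _)
  -- the Green–Cauchy–Schwarz bound, `μ`-a.e. (finite enstrophy a.e. by (1.29))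
  have hLle : ∀ᵐ u : Torus.energySpace d ∂μ,
      |∫ x, ⟪((u : Lp (EuclideanSpace ℝ d) 2 (volume : Measure (UnitAddTorus d))) :
          UnitAddTorus d → EuclideanSpace ℝ d) x, Torus.laplacian (Φ.grad u) x⟫_ℝ| ≤
        Real.sqrt (Torus.eGradNormSq ((u : Lp (EuclideanSpace ℝ d) 2 (volume : Measure (UnitAddTorus d))) :
          UnitAddTorus d → EuclideanSpace ℝ d)).toReal *
          Real.sqrt (Torus.gradNormSq (Φ.grad u)) := by
    filter_upwards [hμ.ae_eGradNormSq_lt_top] with u hu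
    exact stub_greenCS (Lp.memLp _) hu.ne (Torus.CylindricalTest.isSmooth_grad_holds Φ u)
  -- Cauchy–Schwarz in `L²(μ)`
  have hCS := stub_ensembleCS (ae_of_all _ fun u => ENNReal.toReal_nonneg)
    (ae_of_all _ fun u => Torus.gradNormSq_nonneg _) haI hbI hLle
  have hGa : ∫ u : Torus.energySpace d,
      (Torus.eGradNormSq ((u : Lp (EuclideanSpace ℝ d) 2 (volume : Measure (UnitAddTorus d))) :
        UnitAddTorus d → EuclideanSpace ℝ d)).toReal ∂μ = (Torus.ensembleEnstrophy μ).toReal := by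
    rw [Torus.ensembleEnstrophy,
      integral_toReal Torus.measurable_eGradNormSq_coe.aemeasurable hμ.ae_eGradNormSq_lt_top]
  rw [hid, abs_neg, abs_mul, abs_of_pos hν, mul_assoc]
  refine mul_le_mul_of_nonneg_left ?_ hν.le
  rw [← hGa]
  exact hCS

/-! ## The crux -/

/-- **Residual transfer at the ensemble level** — the route declaration
`EnsembleRigidity.ResidualTransferSSS` (item stmt-AnomalousDissipation-15510): shell positivity of the
work (a) and the Euler defect bound (b) for every stationary statistical solution of NS_ν(f) on `T³`,
`ν > 0`, `f` smooth. The hypotheses `IsDivFree f`, `HasZeroMean f` and `Integrable |v|²` of the item are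
not needed (`f` enters only through `f ∈ L²`). [folklore] -/
theorem ResidualTransferSSS_of :
    Summit.AnomalousDissipation.AnomalousDissipation.Theses.EnsembleRigidity.ResidualTransferSSS := by
  intro ν f μ hν hf _hdiv _hzm hμ _hint
  exact ⟨fun e₁ e₂ he => shellWork_nonneg hν.le (hf.memLp 2) hμ he,
    fun Φ => eulerDefect_le hν (hf.memLp 2) hμ Φ⟩

end Summit.AnomalousDissipation.AnomalousDissipation.Theorems.ResidualTransferSSS

end
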